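import Literature.AnabelianGeometry.SemiGraphs.ArithThm54CapstoneCorollary
import Literature.AnabelianGeometry.SemiGraphs.ArithLevelCofinalityOuterAction
import HarnessLib

/-!
# [SemiAnbd] Prop 5.2 (iv) / Thm 5.4 producer T54-B — the continuity binder `hK1′` DISCHARGED in the
# finite-monodromy regime, and at every split design (proof-only)

Mochizuki, *Semi-graphs of anabelioids*, Publ. RIMS **42** (2006) 221–322, §5: Def 5.1 (i) p. 62 ((c) "the
action of `H` on `𝔾` is trivial; the resulting outer homomorphism `H → Out(π̂₁(𝒢_v))` … is continuous",
(d)), Prop 5.2 (i)/(iv) pp. 63–64 ("every tempered covering of `𝒢` appears as the geometric component of a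
tempered covering of `𝔊`"; the exact sequence `1 → Π^temp_𝒢 → Π^temp_𝔊 → Π_A → 1`), Thm 5.4 (i)(ii) p. 66
[cite: MochizukiSemiAnbd2006, Prop 5.2 (iv), p. 64].

PROOF-ONLY file (abc-iut cell, layer L3, sub-DAG `plan/L3/SUBDAG-SemiAnbd-Thm54.md`, producer row T54-B =
`plan/GAP-LEDGER.md` G-w4d053-1, residual binder «T54·hK1′» of the board of record v5′ (abc-iut-L3-lead α78/α80;
binder text and class DESIGN confirmed by abc-iut-w4-d053 g4, STATUS 2026-08-26T10:21:34Z), seat abc-iut-w6-d117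
gen 2).  No definition, no new named fact, nothing restated: abc-iut-L3-d4's `levelKer` / `arithAct`,
abc-iut-w4-d085's `arithAct_eq_one_of_map_eq_one` (ArithLevelCofinalityOuterAction.lean, p436469) and
abc-iut-w4-d040's `one_prod_mem_outerSemidirectProduct_of_mem_ker` (ArithTotalEstrangementOpenKernelObstruction.lean)
are consumed BY NAME.

THE BINDER.  The integrated corollaries of [SemiAnbd] Thm 5.4 (i) ∧ (ii) at the outer model
`E := π₁^temp(𝒢) ⋊^out_{ρ'} Π_A` (abc-iut-w4-d089 `…_of_producers` p434669, abc-iut-w6-d070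
`…_levelTopology` p435643, abc-iut-w4-d089 `…_of_branchPair` p436680) carry
`hK1' : ∀ n, IsOpen (aug (levelKer (ker ρ_n)))` — at every TREE level `ker ρ_n` (`projAut n`) of the canonical
tower the arithmetic level kernel `levelKer = ker (arithAct) ⊓ ker σ ⊓ centralMod Φ` (abc-iut-L3-d4,
`SubgroupPresentationArithLevels`) surjects onto an OPEN subgroup of `Π_A`.  It is a DESIGN input (print's
Def 5.1 (i)(c) + (d) read at tempered levels through Prop 5.2 (i)); abc-iut-L3-d2 reduced it to the
CONGRUENCE-CONTINUITY of `ρ'` at the level (`ArithLevelKerCongruence.isOpen_map_levelKer_of_congruent_lifts`) and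
supplied that at FINITE levels modulo Nikolov–Segal (`ArithOuterActionNikolovSegal`).  Here, the PARTIAL
PRODUCER in the finite-monodromy regime:

* §1 `SubgroupPresentation.mem_levelKer_of_map_eq_one` — pure group theory: an element of `E` with TRIVIAL
  automorphism component `Φ e = 1` and trivial base action `σ e = 1` lies in `levelKer L` for EVERY `Φ`-stable
  normal level `L` (the `ker (arithAct)` conjunct is abc-iut-w4-d085's `arithAct_eq_one_of_map_eq_one`; the
  other two conjuncts are literal); hence `isOpen_map_levelKer_of_lifts_one`: `aug (levelKer L)` is open as
  soon as every `a` near `1` lifts to such an `e`;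
* §2 at the outer semi-direct product over a chart: `(1, a) ∈ π₁^temp(𝒢) ⋊^out_{ρ'} Π_A` for `a ∈ ker ρ'`
  (abc-iut-w4-d040), so **`ker ρ' ⊓ ker baseAct ≤ aug (levelKer L)`**
  (`ker_inf_ker_le_map_levelKer_outerSemidirectProductSnd` — abc-iut-w4-d085's `ker_inf_ker_le_map_ker_arithAct`
  refined from `ker (arithAct L)` to `levelKer L`) and **`aug (levelKer L)` is open for EVERY level at once
  whenever `ker ρ' ⊓ ker baseAct` is open** (`isOpen_map_levelKer_outerSemidirectProductSnd_of_isOpen_ker`) —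
  the FINITE-MONODROMY (congruence-discrete) regime: `ρ'` and the base action kill an open subgroup of `Π_A`.
  Together with abc-iut-w4-d085's G-w4d085-1 (the weakest binder the (AI4″) route needs is
  `hU : ⨅ₙ aug (ker (arithAct (L n))) ≤ ker ρ' ⊓ ker baseAct`) this says: under `hU` the images
  `aug (levelKer (L n)) ≤ aug (ker (arithAct (L n)))` shrink EXACTLY to `ker ρ' ⊓ ker baseAct`.
* §3 the capstone binder VERBATIM at the canonical tower `𝒢.galoisLevelData h36` (any `T`, `R`, `hP`, `hLst`):
  `hK1'_of_isOpen_ker`, and its instances `hK1'_of_trivial` (`ρ' = 1`, `baseAct = 1`: every SPLIT design of the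
  NV lineage abc-iut-w6-d099 / abc-iut-w4-d040, for every topological group `Π_A`; abc-iut-w6-d099 discharged
  this instance inline in p437549 — here it is one citable term) and `hK1'_of_discrete` (`Π_A` discrete).

HONEST LABEL [finite monodromy: witnessed ≠ endorsed].  This discharges `hK1′` exactly when `ρ' × baseAct` has an
OPEN kernel; it does NOT cover the genuine arithmetic situation of Ex. 5.6 (`Π_A = G_K`, infinite monodromy),
where `hK1′` remains the typed form of Def 5.1 (i)(c) + Prop 5.2 (i) at the tree levels (congruence-continuity
of `ρ'` at `ker ρ_n`, `n` cofinal — abc-iut-L3-d2's reduction, owing `hself` at deep tree levels).  Nothing here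
refers to the IUT corpus; no side is taken on [IUTchIII] Cor. 3.12; typed ≠ proved for the residual inputs.
-/

namespace Literature.AnabelianGeometry.SemiGraphs

open CategoryTheory Topology Filter
open Literature.AnabelianGeometry.EtaleTheta

universe u v w

/-! ### §1 Pure group theory: elements with trivial automorphism component lie in every level kernel -/

namespace SemiGraph

namespace SubgroupPresentation

variable {𝔾 : SemiGraph.{u}} {Γ : Type u} [Group Γ] {E : Type v} [Group E]
  (P : SubgroupPresentation 𝔾 Γ) {Φ : E →* MulAut Γ} {σ : E →* Aut 𝔾}
  (hP : P.IsArithCompatible Φ σ) (L : Subgroup Γ) (hL : ∀ (e : E) (x : Γ), x ∈ L → Φ e x ∈ L)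

/-- **An element of `E` with trivial automorphism component and trivial base action lies in the level
kernel** `levelKer L = ker (arithAct L) ⊓ ker σ ⊓ centralMod Φ L`, for every `Φ`-stable normal level `L`:
it acts trivially on the level-`L` coset semi-graph (abc-iut-w4-d085's `arithAct_eq_one_of_map_eq_one`),
fixes `𝔾`, and `Φ_e(y) y⁻¹ = 1 ∈ L`. [cite: MochizukiSemiAnbd2006, Prop 5.2 (iv), p. 64] -/
theorem mem_levelKer_of_map_eq_one [L.Normal] {e : E} (hΦ : Φ e = 1) (hσ : σ e = 1) :
    e ∈ P.levelKer hP L hL := by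
  rw [P.mem_levelKer_iff hP L hL]
  refine ⟨P.arithAct_eq_one_of_map_eq_one hP L hL hΦ hσ, hσ, fun y => ?_⟩
  rw [hΦ, MulAut.one_apply, mul_inv_cancel]
  exact L.one_mem

/-- Hence `ker Φ ⊓ ker σ ≤ levelKer L` for every `Φ`-stable normal level `L`.
[cite: MochizukiSemiAnbd2006, Prop 5.2 (iv), p. 64] -/
theorem ker_inf_ker_le_levelKer [L.Normal] : Φ.ker ⊓ σ.ker ≤ P.levelKer hP L hL := fun _ he =>
  P.mem_levelKer_of_map_eq_one hP L hL (MonoidHom.mem_ker.mp he.1) (MonoidHom.mem_ker.mp he.2)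

/-- **`hK1′` from lifts with trivial automorphism component**: if every element of some neighbourhood of
`1` in `Π_A` lifts along `aug` to an `e ∈ E` with `Φ e = 1` and `σ e = 1`, then `aug (levelKer L)` is an OPEN
subgroup of `Π_A` — for every `Φ`-stable normal level `L` (the degenerate case of abc-iut-L3-d2's
`isOpen_map_levelKer_of_congruent_lifts`: congruence to the identity modulo `L` is exact, conjugators `1`).
[cite: MochizukiSemiAnbd2006, Prop 5.2 (i), p. 63] -/
theorem isOpen_map_levelKer_of_lifts_one [L.Normal] {A : Type w} [Group A] [TopologicalSpace A]
    [ContinuousMul A] (aug : E →* A) {U : Set A} (hU : U ∈ 𝓝 (1 : A))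
    (hlift : ∀ a ∈ U, ∃ e : E, aug e = a ∧ Φ e = 1 ∧ σ e = 1) :
    IsOpen (((P.levelKer hP L hL).map aug : Subgroup A) : Set A) := by
  apply Subgroup.isOpen_of_mem_nhds _ (g := 1)
  apply Filter.mem_of_superset hU
  intro a ha
  obtain ⟨e, rfl, hΦ, hσ⟩ := hlift a ha
  exact ⟨e, P.mem_levelKer_of_map_eq_one hP L hL hΦ hσ, rfl⟩

end SubgroupPresentation

end SemiGraph

/-! ### §2 At the outer semi-direct product `π₁^temp(𝒢) ⋊^out_{ρ'} Π_A` over a chart: finite monodromy -/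

section Kernels

variable {PA : Type w} [Group PA] [TopologicalSpace PA] {M₁ : Type*} [Group M₁] {M₂ : Type*} [Group M₂]

/-- Two open kernels give an open joint kernel — Def 5.1 (i)(c)/(d)'s two continuity conditions («an open
subgroup acts trivially on `𝔾`»; continuity of the outer representation), in the discrete-target case, combine
to one open subgroup. [cite: MochizukiSemiAnbd2006, Def 5.1 (i), p. 62] -/
theorem isOpen_ker_inf_ker_of_isOpen (f : PA →* M₁) (g : PA →* M₂) (hf : IsOpen (f.ker : Set PA))
    (hg : IsOpen (g.ker : Set PA)) : IsOpen ((f.ker ⊓ g.ker : Subgroup PA) : Set PA) := by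
  rw [Subgroup.coe_inf]
  exact hf.inter hg

end Kernels

namespace ProfiniteSemiGraph

variable {𝒢 : ProfiniteSemiGraph.{u}} (c : TemperedPiChart 𝒢) {PA : Type w} [Group PA]
  (ρ : PA →* TopOut c.G) (baseAct : PA →* Aut 𝒢.graph) (P : SemiGraph.SubgroupPresentation 𝒢.graph c.G)
  (hP : P.IsArithCompatible
    (((contMulAut c.G).subtype.comp (MonoidHom.fst (contMulAut c.G) PA)).comp (outerSemidirectProduct ρ).subtype)
    (baseAct.comp (outerSemidirectProductSnd ρ)))
  (L : Subgroup c.G)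
  (hL : ∀ (e : outerSemidirectProduct ρ) (x : c.G), x ∈ L →
    (((contMulAut c.G).subtype.comp (MonoidHom.fst (contMulAut c.G) PA)).comp (outerSemidirectProduct ρ).subtype)
      e x ∈ L)

/-- **`ker ρ' ⊓ ker baseAct ≤ aug (levelKer L)`** at the outer model, for every stable normal level `L`: over
`a` with `ρ' a = 1` and trivial base action the element `(1, a) ∈ π₁^temp(𝒢) ⋊^out_{ρ'} Π_A` (abc-iut-w4-d040's
`one_prod_mem_outerSemidirectProduct_of_mem_ker`) has trivial automorphism component, hence lies in
`levelKer L` (§1) — abc-iut-w4-d085's `ker_inf_ker_le_map_ker_arithAct` refined from `ker (arithAct L)` to the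
level kernel. [cite: MochizukiSemiAnbd2006, Prop 5.2 (iv), p. 64] -/
theorem ker_inf_ker_le_map_levelKer_outerSemidirectProductSnd (hLn : L.Normal) :
    ρ.ker ⊓ baseAct.ker ≤ (P.levelKer hP L hL).map (outerSemidirectProductSnd ρ) := by
  haveI := hLn
  intro a ha
  refine ⟨⟨((1 : contMulAut c.G), a), one_prod_mem_outerSemidirectProduct_of_mem_ker c ρ ha.1⟩,
    P.mem_levelKer_of_map_eq_one hP L hL rfl ?_, rfl⟩
  change baseAct (outerSemidirectProductSnd ρ _) = 1
  exact MonoidHom.mem_ker.mp ha.2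

/-- **`hK1′` IN THE FINITE-MONODROMY REGIME**: if `ker ρ' ⊓ ker baseAct` is OPEN in `Π_A` (the outer action
and the base action kill an open subgroup — congruence-continuity for the discrete topology), then
`aug (levelKer L)` is open for EVERY stable normal level `L` of `π₁^temp(𝒢)` at once.
[cite: MochizukiSemiAnbd2006, Prop 5.2 (iv), p. 64] -/
theorem isOpen_map_levelKer_outerSemidirectProductSnd_of_isOpen_ker (hLn : L.Normal) [TopologicalSpace PA]
    [ContinuousMul PA] (hopen : IsOpen ((ρ.ker ⊓ baseAct.ker : Subgroup PA) : Set PA)) :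
    IsOpen (((P.levelKer hP L hL).map (outerSemidirectProductSnd ρ) : Subgroup PA) : Set PA) :=
  Subgroup.isOpen_mono (ker_inf_ker_le_map_levelKer_outerSemidirectProductSnd c ρ baseAct P hP L hL hLn) hopen

/-- The same with the hypothesis as a neighbourhood of `1` (an open subgroup INSIDE `ker ρ' ⊓ ker baseAct`
suffices). [cite: MochizukiSemiAnbd2006, Prop 5.2 (iv), p. 64] -/
theorem isOpen_map_levelKer_outerSemidirectProductSnd_of_ker_mem_nhds (hLn : L.Normal) [TopologicalSpace PA]
    [ContinuousMul PA] (hnhds : ((ρ.ker ⊓ baseAct.ker : Subgroup PA) : Set PA) ∈ 𝓝 (1 : PA)) :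
    IsOpen (((P.levelKer hP L hL).map (outerSemidirectProductSnd ρ) : Subgroup PA) : Set PA) :=
  isOpen_map_levelKer_outerSemidirectProductSnd_of_isOpen_ker c ρ baseAct P hP L hL hLn
    (Subgroup.isOpen_of_mem_nhds _ hnhds)

/-! ### §3 The capstone binder `hK1′` VERBATIM at the canonical tower -/

/-- **`hK1′` of the T54 capstone corollaries (abc-iut-w6-d070 `canonicalArithLevelTopology` /
`…_piPresentation_levelTopology`, p435643; abc-iut-w4-d089 `…_of_producers` / `…_of_branchPair`) DISCHARGED in
the finite-monodromy regime**: at the canonical tower `𝒢.galoisLevelData h36`, for every presentation datum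
`T`, `R`, every compatibility `hP` and finite-level stability `hLst`, if `ker ρ' ⊓ ker baseAct` is open in `Π_A`
then at every tree level `ker ρ_n` the arithmetic level kernel surjects onto an open subgroup of `Π_A`.
[cite: MochizukiSemiAnbd2006, Prop 5.2 (iv), p. 64] -/
theorem hK1'_of_isOpen_ker (h36 : 𝒢.Prop36Hypotheses)
    {PA : Type w} [Group PA] [TopologicalSpace PA] [ContinuousMul PA]
    (ρ' : PA →* TopOut (𝒢.temperedPiChart h36).G) (baseAct : PA →* Aut 𝒢.graph)
    (T : ∀ w : 𝒢.graph.Vertex, (𝒢.galoisLevelData h36).PointSeq h36.isCountable w)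
    (R : SemiGraph.RefBranches 𝒢.graph)
    (hP : ((𝒢.galoisLevelData h36).piPresentation h36.isCountable T R).IsArithCompatible
      (((contMulAut (𝒢.temperedPiChart h36).G).subtype.comp
        (MonoidHom.fst (contMulAut (𝒢.temperedPiChart h36).G) PA)).comp (outerSemidirectProduct ρ').subtype)
      (baseAct.comp (outerSemidirectProductSnd ρ')))
    (hLst : ∀ (n : ℕ) (e : outerSemidirectProduct ρ') (x : (𝒢.temperedPiChart h36).G),
      x ∈ ((𝒢.galoisLevelData h36).piLevelAut h36.isCountable (𝒢.galoisLevelData_hconn h36) n).ker →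
        (((contMulAut (𝒢.temperedPiChart h36).G).subtype.comp
          (MonoidHom.fst (contMulAut (𝒢.temperedPiChart h36).G) PA)).comp (outerSemidirectProduct ρ').subtype)
          e x ∈ ((𝒢.galoisLevelData h36).piLevelAut h36.isCountable (𝒢.galoisLevelData_hconn h36) n).ker)
    (hker : IsOpen ((ρ'.ker ⊓ baseAct.ker : Subgroup PA) : Set PA)) :
    ∀ n, IsOpen (((((𝒢.galoisLevelData h36).piPresentation h36.isCountable T R).levelKer hP
        ((𝒢.galoisLevelData h36).projAut h36.isCountable n).ker
        ((𝒢.galoisLevelData h36).hKst_of_hLst_outerAction h36.isCountable (𝒢.galoisLevelData_hconn h36)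
          T R ρ' hP hLst n)).map (outerSemidirectProductSnd ρ') : Subgroup PA) : Set PA) := fun _ =>
  isOpen_map_levelKer_outerSemidirectProductSnd_of_isOpen_ker (𝒢.temperedPiChart h36) ρ' baseAct _ hP _ _
    (MonoidHom.normal_ker _) hker

/-- **`hK1′` at every SPLIT design** (`ρ' = 1`, trivial base action — the designs at which abc-iut-w6-d099 /
abc-iut-w4-d040 inhabit the other design inputs of the capstone), for EVERY topological group `Π_A`: the binder
holds outright. [cite: MochizukiSemiAnbd2006, Prop 5.2 (iv), p. 64] -/
theorem hK1'_of_trivial (h36 : 𝒢.Prop36Hypotheses)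
    {PA : Type w} [Group PA] [TopologicalSpace PA] [ContinuousMul PA]
    (T : ∀ w : 𝒢.graph.Vertex, (𝒢.galoisLevelData h36).PointSeq h36.isCountable w)
    (R : SemiGraph.RefBranches 𝒢.graph)
    (hP : ((𝒢.galoisLevelData h36).piPresentation h36.isCountable T R).IsArithCompatible
      (((contMulAut (𝒢.temperedPiChart h36).G).subtype.comp
        (MonoidHom.fst (contMulAut (𝒢.temperedPiChart h36).G) PA)).comp
          (outerSemidirectProduct (1 : PA →* TopOut (𝒢.temperedPiChart h36).G)).subtype)
      ((1 : PA →* Aut 𝒢.graph).comp (outerSemidirectProductSnd (1 : PA →* TopOut (𝒢.temperedPiChart h36).G))))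
    (hLst : ∀ (n : ℕ) (e : outerSemidirectProduct (1 : PA →* TopOut (𝒢.temperedPiChart h36).G))
      (x : (𝒢.temperedPiChart h36).G),
      x ∈ ((𝒢.galoisLevelData h36).piLevelAut h36.isCountable (𝒢.galoisLevelData_hconn h36) n).ker →
        (((contMulAut (𝒢.temperedPiChart h36).G).subtype.comp
          (MonoidHom.fst (contMulAut (𝒢.temperedPiChart h36).G) PA)).comp
            (outerSemidirectProduct (1 : PA →* TopOut (𝒢.temperedPiChart h36).G)).subtype)
          e x ∈ ((𝒢.galoisLevelData h36).piLevelAut h36.isCountable (𝒢.galoisLevelData_hconn h36) n).ker) :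
    ∀ n, IsOpen (((((𝒢.galoisLevelData h36).piPresentation h36.isCountable T R).levelKer hP
        ((𝒢.galoisLevelData h36).projAut h36.isCountable n).ker
        ((𝒢.galoisLevelData h36).hKst_of_hLst_outerAction h36.isCountable (𝒢.galoisLevelData_hconn h36)
          T R (1 : PA →* TopOut (𝒢.temperedPiChart h36).G) hP hLst n)).map
          (outerSemidirectProductSnd (1 : PA →* TopOut (𝒢.temperedPiChart h36).G)) : Subgroup PA) :
            Set PA) := by
  refine hK1'_of_isOpen_ker h36 (1 : PA →* TopOut (𝒢.temperedPiChart h36).G) (1 : PA →* Aut 𝒢.graph)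
    T R hP hLst ?_
  rw [MonoidHom.ker_one, MonoidHom.ker_one, inf_top_eq, Subgroup.coe_top]
  exact isOpen_univ

/-- **`hK1′` for a DISCRETE (e.g. finite) `Π_A`**, any outer action and base action.
[cite: MochizukiSemiAnbd2006, Prop 5.2 (iv), p. 64] -/
theorem hK1'_of_discrete (h36 : 𝒢.Prop36Hypotheses)
    {PA : Type w} [Group PA] [TopologicalSpace PA] [DiscreteTopology PA]
    (ρ' : PA →* TopOut (𝒢.temperedPiChart h36).G) (baseAct : PA →* Aut 𝒢.graph)
    (T : ∀ w : 𝒢.graph.Vertex, (𝒢.galoisLevelData h36).PointSeq h36.isCountable w)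
    (R : SemiGraph.RefBranches 𝒢.graph)
    (hP : ((𝒢.galoisLevelData h36).piPresentation h36.isCountable T R).IsArithCompatible
      (((contMulAut (𝒢.temperedPiChart h36).G).subtype.comp
        (MonoidHom.fst (contMulAut (𝒢.temperedPiChart h36).G) PA)).comp (outerSemidirectProduct ρ').subtype)
      (baseAct.comp (outerSemidirectProductSnd ρ')))
    (hLst : ∀ (n : ℕ) (e : outerSemidirectProduct ρ') (x : (𝒢.temperedPiChart h36).G),
      x ∈ ((𝒢.galoisLevelData h36).piLevelAut h36.isCountable (𝒢.galoisLevelData_hconn h36) n).ker →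
        (((contMulAut (𝒢.temperedPiChart h36).G).subtype.comp
          (MonoidHom.fst (contMulAut (𝒢.temperedPiChart h36).G) PA)).comp (outerSemidirectProduct ρ').subtype)
          e x ∈ ((𝒢.galoisLevelData h36).piLevelAut h36.isCountable (𝒢.galoisLevelData_hconn h36) n).ker) :
    ∀ n, IsOpen (((((𝒢.galoisLevelData h36).piPresentation h36.isCountable T R).levelKer hP
        ((𝒢.galoisLevelData h36).projAut h36.isCountable n).ker
        ((𝒢.galoisLevelData h36).hKst_of_hLst_outerAction h36.isCountable (𝒢.galoisLevelData_hconn h36)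
          T R ρ' hP hLst n)).map (outerSemidirectProductSnd ρ') : Subgroup PA) : Set PA) :=
  hK1'_of_isOpen_ker h36 ρ' baseAct T R hP hLst (isOpen_discrete _)

end ProfiniteSemiGraph

end Literature.AnabelianGeometry.SemiGraphs
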